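import Summits.QuantumFields.BalabanUV.T4Continuum.Support.B13StepOfRecordSub
import Summits.QuantumFields.BalabanUV.T4Continuum.Support.SubstrateSlotsOfRecordShift

/-!
# B13StepOfRecordSubstrateShiftLetters — NE5 ∕ U3: THE THREE LETTER LEMMAS OF p221190 §1 ∕ §2 AT THE SUBSTRATE's **LEVEL-SHIFTED** SLOTS OF RECORD
# `SubstrateSlotsOfRecordShift.slotsOfRecordShift` (W-21 = L-E15; NE5 owner RULINGS R53 ∕ R54): the sub-slot MEMBERSHIP side conditions `hMA ∕ hMB` at
# `M := B13OpMeasurable.measOp` and the L01 reading `hT`, from LETTER CONDITIONS — ONE HOME for every re-pointed E1 END on `measOp` (cores road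
# leaf-08, E9 road leaf-03, InsOp road leaf-10, E8[rec] road leaf-01) to import BY NAME (cell `pub-balaban`, T⁴ fan-out, `HOME/BINDER-OWNERS.md` row NE5;
# unit `b2b-balaban-t4-ne5-formalise-leaf-08`, gen 13; journal QUESTION l.20272 → this module = its option (b), filed as a separate home so that no road
# module has to be imported for the letters; CREDIT: statements and proof terms are leaf-01-g11's `B13StepOfRecordSubstrate` §1 ∕ §2 (p221190) with
# `slotsOfRecord ↦ slotsOfRecordShift`)

HONEST FRAMING (T4-DAG PAGE 1).  Rung (B)+1 on ONE finite four-torus of fixed physical size — NOT infinite volume, NOT a mass gap, NOT the Clay problem;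
`FlowStep.BetaPertH`, (B), (B^μ) do not occur here.  NE5 is NOT PRINTED and NOT PROVED (spine 0/9).  Three [folklore] bookkeeping lemmas, 0 `def`,
0 cite tags, no estimate; nothing of the substrate's letters or of Bałaban's objects is asserted.  The O1 INSTANCE and its level shift are the SUBSTRATE
cell's (Q-NE9-O1, DESIGN RULE R34, W-21).  HONEST DEPENDENCY (cell, verbatim): continuum YM on T⁴ ⇐ BetaPertH ∧ nine spine estimates (0/9 proved);
BetaPertH ⇐ (D1) ∧ (D4) ∧ CAP+tail; G-an2-4 gates asym, D1 and NE2/3/4.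

WHAT (the (α) COV-ONLY shift touches run B's `.cov` slot only — W-21 §2's `rfl` views —, so the three proofs are p221190's VERBATIM at the new slots):
* `opA_mem_measOp_slotsOfRecordShift` — run A's operator data of the shifted instance lie in `measOp` (run A's raw slot is `slotsOfRecord`'s; leaf-03's
  `B13StepOfRecordSub.opA_mem_measOp` BY NAME) from the three run-A letter conditions `hbdA hmQA hmRA`;
* `opB_mem_measOp_slotsOfRecordShift` — run B's, from `hbdB hmQB hmRB` where `hbdB` is the format-boundedness of the SHIFTED raw record
  `rawBOfRecordShift D ι c a s L.ΓB L.dkB L.gcB L.pQB L.pRB` (argument order `D ι` as in W-21) and the two potential-table measurability conditions are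
  unchanged (`B13StepOfRecordSub.opB_mem_measOp` BY NAME);
* `transportReads_slotsOfRecordShift_of_factor` — the L01 reading at the shifted instance from the factorisation datum `(iopAt, hiopA)` (the insertion
  datum is `insDatumOfRecord D L.ins`, W-21 `slotsOfRecordShift_D`; O1-e's `Assembly.transportReads_of_insOpAt` BY NAME).
CENSUS vs p221190 §1 ∕ §2 (binders, by name): MINUS = ∅; PLUS = ∅; inside `hbdB`: `rawBOfRecord ι D ↦ rawBOfRecordShift D ι`.  0 sorry; axioms ⊆
{propext, Classical.choice, Quot.sound}.
-/

noncomputable section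

open Metric Set MeasureTheory

namespace Summit.QuantumFields.BalabanUV.T4Continuum.B13StepOfRecordSubstrateShiftLetters

open Literature.MathematicalPhysics.QuantumFieldTheory.Balaban1983to89
open Literature.MathematicalPhysics.QuantumFieldTheory.Balaban1983to89.B5Prop11Plancherel (Tor)
open Summit.QuantumFields.BalabanUV.T4Continuum.B13OpDatum (OpDatum Species FormatBounded B13Weights)
open Summit.QuantumFields.BalabanUV.T4Continuum.B13OpDatumJunctions (opOf)
open Summit.QuantumFields.BalabanUV.T4Continuum.B13OpMeasurable (measOp)
open Summit.QuantumFields.BalabanUV.T4Continuum.B13HistMeasurable (MeasPotFrame B13HistM)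
open Summit.QuantumFields.BalabanUV.T4Continuum.B13StepTermLabels (InnerLabel)
open Summit.QuantumFields.BalabanUV.T4Continuum.B13InnerData (Bnd)
open Summit.QuantumFields.BalabanUV.T4Continuum.B13StepOfRecord (Slots assembly step)
open Summit.QuantumFields.BalabanUV.T4Continuum.B13StepOfRecordSub (opA_mem_measOp opB_mem_measOp)
open Summit.QuantumFields.BalabanUV.T4Continuum.SubstrateBackgroundTransporters (unitMod)
open Summit.QuantumFields.BalabanUV.T4Continuum.SubstrateTwoRunsDriven (DrivenRuns)
open Summit.QuantumFields.BalabanUV.T4Continuum.SubstrateRawSpecies (rawAOfRecord rawBOfRecord)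
open Summit.QuantumFields.BalabanUV.T4Continuum.SubstrateSlotsOfRecord (SpeciesRec SlotLetters slotsOfRecord)
open Summit.QuantumFields.BalabanUV.T4Continuum.SubstrateSlotsOfRecordShift (rawBOfRecordShift slotsOfRecordShift)

variable {G : Type} [GaugeGroup G] (D : DrivenRuns G)
variable {o : Type} [Fintype o] [DecidableEq o] (ι : G →* Matrix o o ℂ) (c : ℂ) (a : ℝ) (s : ℕ → ℂ)
variable {T ι' S Ω 𝒴 : Type} (P : MeasPotFrame D.carriers) {IOp : Type*}
  (𝒵 : D.carriers.Dom → InnerLabel D.carriers.Dom (Bnd D.toTwoRuns) → Type) [∀ Z j, Fintype (𝒵 Z j)] (dom : ∀ Z j, 𝒵 Z j → D.carriers.Dom)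
  (Jc : D.carriers.Dom → InnerLabel D.carriers.Dom (Bnd D.toTwoRuns) → Type) [∀ Z j, Fintype (Jc Z j)]
  (V : D.carriers.Dom → InnerLabel D.carriers.Dom (Bnd D.toTwoRuns) → Type) [∀ Z j, NormedAddCommGroup (V Z j)]
  [∀ Z j, InnerProductSpace ℝ (V Z j)] [∀ Z j, MeasurableSpace (V Z j)] [∀ Z j, BorelSpace (V Z j)] [∀ Z j, FiniteDimensional ℝ (V Z j)]
  (mI : D.carriers.Dom → InnerLabel D.carriers.Dom (Bnd D.toTwoRuns) → Type) [∀ Z j, Fintype (mI Z j)] [∀ Z j, DecidableEq (mI Z j)]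
variable (L : SlotLetters D (o := o) (T := T) (ι' := ι') (S := S) (Ω := Ω) (𝒴 := 𝒴) P (IOp := IOp) 𝒵 dom Jc V mI)

/-! ## §1 The sub-slot membership side conditions `hMA` ∕ `hMB` at the shifted instance, from letter conditions -/

section MeasOp

variable [MeasurableSpace Ω]

/-- [folklore] **RUN A's OPERATOR DATA OF THE SHIFTED SUBSTRATE INSTANCE LIE IN THE MEASURABLE SLOT** — p221190 §1's
`opA_mem_measOp_slotsOfRecord` with `slotsOfRecord ↦ slotsOfRecordShift` (run A's raw slot is untouched by the (α) COV-ONLY shift; the proof term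
is leaf-01's VERBATIM over leaf-03's `opA_mem_measOp`): VERBATIM the hypothesis `hMA` of every restricted END face of record at
`S₀ := slotsOfRecordShift …`, `M := measOp`, from the three run-A LETTER conditions. -/
theorem opA_mem_measOp_slotsOfRecordShift
    (hbdA : ∀ (g : ℕ → ℝ) (U : D.carriers.BgA) (k : ℕ),
      FormatBounded (L.W k).format (rawAOfRecord ι D c a s L.ΓA L.dkA L.gcA L.pQA L.pRA g U k).kernel)
    (hmQA : ∀ (r : ℝ) (U : GaugeField (D.F.P D.K) 0 G) (k : ℕ) (Y : 𝒴) (b b' : ((Tor (unitMod (D.F.P D.K)) × Fin (D.F.P D.K).d) × o)),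
        Measurable fun x : Ω => L.pQA r U k x Y b b')
    (hmRA : ∀ (r : ℝ) (U : GaugeField (D.F.P D.K) 0 G) (k : ℕ) (Y : 𝒴), Measurable fun x : Ω => L.pRA r U k x Y) :
    ∀ (g : ℕ → ℝ) (U : D.carriers.BgA) (k : ℕ), opOf (slotsOfRecordShift D ι c a s P 𝒵 dom Jc V mI L).F
        (slotsOfRecordShift D ι c a s P 𝒵 dom Jc V mI L).rawA g U k ∈ measOp T ((Tor (unitMod (D.F.P D.K)) × Fin (D.F.P D.K).d) × o) ι' Ω 𝒴 :=
  opA_mem_measOp (slotsOfRecordShift D ι c a s P 𝒵 dom Jc V mI L) hbdA (fun g U k Y b b' => hmQA (g (k - 1)) U.1 k Y b b')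
    (fun g U k Y => hmRA (g (k - 1)) U.1 k Y) (fun _ _ _ _ => measurable_const) (fun _ _ => measurable_const)

/-- [folklore] **RUN B's OPERATOR DATA OF THE SHIFTED SUBSTRATE INSTANCE LIE IN THE MEASURABLE SLOT** — p221190 §1's
`opB_mem_measOp_slotsOfRecord` with `slotsOfRecord ↦ slotsOfRecordShift`: VERBATIM `hMB` at the shifted instance, from the run-B letter conditions —
format-boundedness now of the SHIFTED raw record `rawBOfRecordShift D ι …` (W-21), the two potential tables' measurability in the field argument
unchanged (the shift touches `.cov` only); proof term leaf-01's VERBATIM over leaf-03's `opB_mem_measOp`. -/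
theorem opB_mem_measOp_slotsOfRecordShift
    (hbdB : ∀ (g : ℕ → ℝ) (U : D.carriers.BgB) (k : ℕ),
      FormatBounded (L.W k).format (rawBOfRecordShift D ι c a s L.ΓB L.dkB L.gcB L.pQB L.pRB g U k).kernel)
    (hmQB : ∀ (r : ℝ) (U : GaugeField (D.F.P (D.K + 1)) 0 G) (k : ℕ) (Y : 𝒴) (b b' : ((Tor (unitMod (D.F.P D.K)) × Fin (D.F.P D.K).d) × o)),
        Measurable fun x : Ω => L.pQB r U k x Y b b')
    (hmRB : ∀ (r : ℝ) (U : GaugeField (D.F.P (D.K + 1)) 0 G) (k : ℕ) (Y : 𝒴), Measurable fun x : Ω => L.pRB r U k x Y) :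
    ∀ (g : ℕ → ℝ) (U : D.carriers.BgB) (k : ℕ), opOf (slotsOfRecordShift D ι c a s P 𝒵 dom Jc V mI L).F
        (slotsOfRecordShift D ι c a s P 𝒵 dom Jc V mI L).rawB g U k ∈ measOp T ((Tor (unitMod (D.F.P D.K)) × Fin (D.F.P D.K).d) × o) ι' Ω 𝒴 :=
  opB_mem_measOp (slotsOfRecordShift D ι c a s P 𝒵 dom Jc V mI L) hbdB (fun g U k Y b b' => hmQB (g (k - 1)) U.1 k Y b b')
    (fun g U k Y => hmRB (g (k - 1)) U.1 k Y) (fun _ _ _ _ => measurable_const) (fun _ _ => measurable_const)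

end MeasOp

/-! ## §2 The L01 reading `TransportReads` at the shifted instance -/

/-- [folklore] **THE L01 READING HOLDS AT THE SHIFTED INSTANCE AS SOON AS `iopA` FACTORS THROUGH THE TRANSPORT** — p221190 §2's
`transportReads_slotsOfRecord_of_factor` with `slotsOfRecord ↦ slotsOfRecordShift` (the insertion datum is `slotsOfRecord`'s by W-21's
`slotsOfRecordShift_D`, `rfl`); O1-e's `transportReads_of_insOpAt` BY NAME. -/
theorem transportReads_slotsOfRecordShift_of_factor (iopAt : ℝ → D.carriers.BgA → ℕ → IOp)
    (hiopA : ∀ (r : ℝ) (U : D.carriers.BgB) (k : ℕ), L.ins.iopA r U k = iopAt r (D.carriers.transport U) k) (W : Set (ℕ → ℝ)) :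
    (assembly (slotsOfRecordShift D ι c a s P 𝒵 dom Jc V mI L)).TransportReads W :=
  (assembly (slotsOfRecordShift D ι c a s P 𝒵 dom Jc V mI L)).transportReads_of_insOpAt (insOpA' := fun g U k => iopAt (g (k - 1)) U k)
    (fun g U k => hiopA (g (k - 1)) U k) W

end Summit.QuantumFields.BalabanUV.T4Continuum.B13StepOfRecordSubstrateShiftLetters

end
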